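import Summits.BirchSwinnertonDyer.BirchSwinnertonDyer.Theorems.ManinLocalTwoThreePShiftPairDescent
import Summits.BirchSwinnertonDyer.BirchSwinnertonDyer.Theorems.ManinLocalTwoThreePShiftStepFermatQuotient
import HarnessLib

/-!
# The prime-generic descent engine, VII: the EIGEN step at `p² ∥ N` — `K^ε_p(pm) = 0 ⟹ K^ε_p(p²m) = 0` (`p ∤ m`, `ε ≠ 0, 1`, `p` odd)
# (route `ManinLocalTwoThree`, cell bsd-f2-manin; cruxes C2 stmt-BirchSwinnertonDyer-22967 / C3 stmt-…-22968; LEAD seat p1 gen 12)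

The `p`-generic form of es's THEOREM V («two functionals and ONE explicit pair», MEMO-es §37.13 (B); the seat's g11
`…ThreeShiftAntiDescentThree` at `p = 3`, `ε = −1`).  Let `ψ : Γ₀(p²m) → ℤ/p` be additive with `ψ(a, pb; c, d) = ε ψ(a, b; pc, d)`,
`p ∤ m`, `ε ≠ 0, 1`.  On `G = Γ₀(pm) ⊇ A = {p ∣ b}, B = Γ₀(p²m)` the Fermat-quotient function `χ_G(γ) := fq(d_γ)` (file III) is additive on
`A` and on `B` (not on `G`).  If `Δ := ψ(P_{2/p}) − ψ(P_{1/p}) ≠ 0`, the pair `(χ_G − c·coshift ψ ε, χ_G − c·restr ψ)` with `c := −m (εΔ)⁻¹`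
passes the `κ`-test (`χ_G(TQ₁T⁻¹) − χ_G(Q₁) = fq(1+2pm) − fq(1+pm) = −m`), so it glues to an additive `w` on `Γ₀(pm)` (file VI `descentPair`);
but the EXPLICIT `h = (1 − 2r + 2pur, 1 − 2ur; −pm·rv, r + 1 − pur) ∈ Γ₀(pm)` (`p = 2r+1`, `up + vm = 1`) satisfies `h P_{1/p} = P_{2/p} h`,
whence `w(P_{2/p}) = w(P_{1/p})`, i.e. `−m = cΔ = −m ε⁻¹`, `ε = 1` — contradiction.  Hence **`apply_P2p_eq_apply_P1p_of_eigen`** and, with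
file II's `descent`, **`stepEigen_of_not_dvd : K^ε_p(pm) = 0 ⟹ K^ε_p(p²m) = 0`**.  Nothing about BSD, Manin's conjecture or C2/C3 is asserted.
[cite: DarmonDiamondTaylor1995, Lemma 4.28 (p. 135) (shape only)]
-/

set_option autoImplicit false
set_option linter.dupNamespace false

open scoped MatrixGroups

open CongruenceSubgroup Matrix.SpecialLinearGroup
  Summit.BirchSwinnertonDyer.Rank1Residual.ManinAdditive.NineShiftEqualiser

namespace Summit.BirchSwinnertonDyer.BirchSwinnertonDyer.Theorems.ManinLocalTwoThree

namespace PShiftEngine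

open ThreeShiftDescent TwoShift PShiftTransfer PShiftGlue

variable {p : ℕ} [Fact p.Prime] {m : ℕ}

/-! ### §1. `χ_G = fq ∘ d` on `Γ₀(pm)`: additive on `A = {p ∣ b}` and on `B = {p²m ∣ c}` -/

omit [Fact p.Prime] in
/-- For `γ ∈ Γ₀(pm)`: `p ∣ c_γ`. [folklore] -/
theorem p_dvd_c (γ : Gamma0 (p * m)) : (p : ℤ) ∣ ((γ : SL(2, ℤ)) 1 0 : ℤ) :=
  dvd_trans ⟨(m : ℤ), by push_cast; ring⟩ ((ZMod.intCast_zmod_eq_zero_iff_dvd _ _).mp (Gamma0_mem.mp γ.2))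

omit [Fact p.Prime] in
/-- For `γ ∈ Γ₀(pm)`: `d_γ` is prime to `p`. [folklore] -/
theorem isCoprime_d_pm (γ : Gamma0 (p * m)) : IsCoprime (((γ : SL(2, ℤ)) 1 1 : ℤ)) (p : ℤ) := by
  obtain ⟨k, hk⟩ := p_dvd_c (p := p) (m := m) γ
  have h := gamma0_det_entries γ
  refine ⟨((γ : SL(2, ℤ)) 0 0 : ℤ), -(((γ : SL(2, ℤ)) 0 1 : ℤ) * k), ?_⟩
  rw [hk] at h
  linear_combination h

/-- `fq(d_{xy}) = fq(d_x) + fq(d_y)` whenever `p² ∣ c_x b_y` (`d_{xy} = c_x b_y + d_x d_y`). [folklore] -/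
theorem fq_d_mul (x y : Gamma0 (p * m)) (h2 : (p : ℤ) ^ 2 ∣ ((x : SL(2, ℤ)) 1 0 : ℤ) * (y : SL(2, ℤ)) 0 1) :
    fq p ((((x * y : Gamma0 (p * m)) : SL(2, ℤ)) 1 1 : ℤ)) = fq p (((x : SL(2, ℤ)) 1 1 : ℤ)) + fq p (((y : SL(2, ℤ)) 1 1 : ℤ)) := by
  obtain ⟨k, hk⟩ := h2
  have e : (((x * y : Gamma0 (p * m)) : SL(2, ℤ)) 1 1 : ℤ) =
      (x : SL(2, ℤ)) 1 0 * (y : SL(2, ℤ)) 0 1 + (x : SL(2, ℤ)) 1 1 * (y : SL(2, ℤ)) 1 1 := by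
    simp [Matrix.mul_apply, Fin.sum_univ_two]
  have hcop : IsCoprime ((((x * y : Gamma0 (p * m)) : SL(2, ℤ)) 1 1 : ℤ)) (p : ℤ) := isCoprime_d_pm (x * y)
  rw [e] at hcop ⊢
  rw [← fq_mul (isCoprime_d_pm x) (isCoprime_d_pm y)]
  exact fq_congr hcop ((isCoprime_d_pm x).mul_left (isCoprime_d_pm y)) (Int.modEq_iff_dvd.mpr ⟨-k, by rw [hk]; ring⟩)

/-- `χ_G` is additive on `A = {p ∣ b}` (`p ∣ c_x`, `p ∣ b_y`). [folklore] -/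
theorem fq_d_add_stabZero : ∀ x ∈ stabZero p (p * m), ∀ y ∈ stabZero p (p * m),
    fq p ((((x * y : Gamma0 (p * m)) : SL(2, ℤ)) 1 1 : ℤ)) = fq p (((x : SL(2, ℤ)) 1 1 : ℤ)) + fq p (((y : SL(2, ℤ)) 1 1 : ℤ)) := by
  intro x _ y hy
  obtain ⟨k, hk⟩ := p_dvd_c (p := p) (m := m) x
  obtain ⟨b, hb⟩ := mem_stabZero_iff.mp hy
  exact fq_d_mul x y ⟨k * b, by rw [hk, hb]; ring⟩

/-- `χ_G` is additive on `B = {p²m ∣ c}` (`p² ∣ c_x`). [folklore] -/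
theorem fq_d_add_subB : ∀ x ∈ subB p m, ∀ y ∈ subB p m,
    fq p ((((x * y : Gamma0 (p * m)) : SL(2, ℤ)) 1 1 : ℤ)) = fq p (((x : SL(2, ℤ)) 1 1 : ℤ)) + fq p (((y : SL(2, ℤ)) 1 1 : ℤ)) := by
  intro x hx y _
  obtain ⟨k, hk⟩ := mem_subB.mp hx
  exact fq_d_mul x y ⟨k * m * ((y : SL(2, ℤ)) 0 1 : ℤ), by rw [hk]; push_cast; ring⟩

/-! ### §2. The eigen step at `p² ∥ N` -/

/-- **The obstruction vanishes for eigenvalue `ε ≠ 0, 1` when `p ∤ m` (`p` odd)**: for `ψ : Γ₀(p²m) → ℤ/p` additive with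
`ψ(a, pb; c, d) = ε ψ(a, b; pc, d)`, `ψ(P_{2/p}) = ψ(P_{1/p})` — es's two-functionals-and-one-explicit-pair argument. [new: THEOREM V for every odd p] -/
theorem apply_P2p_eq_apply_P1p_of_eigen (hp2 : p ≠ 2) (hm : 0 < m) (hpm : ¬ p ∣ m) (ψ : Gamma0 (p * (p * m)) → ZMod p)
    {ε : ZMod p} (hε0 : ε ≠ 0) (hε1 : ε ≠ 1) (hadd : IsAdd ψ) (hinv : IsShiftEigenP p ε ψ) :
    ψ (P2p p m) = ψ (P1p p m) := by
  have hp : p.Prime := Fact.out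
  by_contra hne
  set Δ : ZMod p := ψ (P2p p m) - ψ (P1p p m) with hΔ
  have hΔ0 : Δ ≠ 0 := fun h => hne (sub_eq_zero.mp h)
  have hm0 : ((m : ℤ) : ZMod p) ≠ 0 := by
    rw [Int.cast_natCast, Ne, ZMod.natCast_eq_zero_iff]; exact hpm
  -- the coefficient `c` with `c ε Δ = −m`
  set c : ZMod p := -((m : ℤ) : ZMod p) * (ε * Δ)⁻¹ with hc
  have hcεΔ : c * (ε * Δ) = -((m : ℤ) : ZMod p) := by
    rw [hc, mul_assoc, inv_mul_cancel₀ (mul_ne_zero hε0 hΔ0), mul_one]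
  -- the pair
  set α : Gamma0 (p * m) → ZMod p := fun g => fq p (((g : SL(2, ℤ)) 1 1 : ℤ)) - c * coshift ψ ε g with hα
  set β : Gamma0 (p * m) → ZMod p := fun g => fq p (((g : SL(2, ℤ)) 1 1 : ℤ)) - c * restr ψ g with hβ
  have hcoA := coshift_add ψ ε hadd (M := p * m)
  have hreB := restr_add_subB (p := p) (m := m) ψ hadd
  have hαadd : ∀ x ∈ stabZero p (p * m), ∀ y ∈ stabZero p (p * m), α (x * y) = α x + α y := by
    intro x hx y hy
    simp only [hα]
    rw [fq_d_add_stabZero x hx y hy, hcoA x hx y hy]; ring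
  have hβadd : ∀ x ∈ subB p m, ∀ y ∈ subB p m, β (x * y) = β x + β y := by
    intro x hx y hy
    simp only [hβ]
    rw [fq_d_add_subB x hx y hy, hreB x hx y hy]; ring
  have hC : ∀ x ∈ stabZero p (p * m), x ∈ subB p m → α x = β x := by
    intro x hx hxB
    simp only [hα, hβ]
    rw [coshift_eq_restr_subB ψ ε hinv x hx hxB]
  -- the κ-test
  have hdQ : (((Q1 p m : Gamma0 (p * m)) : SL(2, ℤ)) 1 1 : ℤ) = 1 + (p : ℤ) * m := by
    simp only [Q1, g0Of, slOf_apply_11]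
  have hdTQ : (((Tpow (p * m) 1 * Q1 p m * (Tpow (p * m) 1)⁻¹ : Gamma0 (p * m)) : SL(2, ℤ)) 1 1 : ℤ) = 1 + (p : ℤ) * (2 * m) := by
    rw [Tpow_inv, Q1, Tpow_one_mul_mul_Tpow_neg_one _ _ _ _ _ _ (by ring)]
    simp only [g0Of, slOf_apply_11]; ring
  have hκ : α (Tpow (p * m) 1 * Q1 p m * (Tpow (p * m) 1)⁻¹) = α (Q1 p m) := by
    simp only [hα]
    rw [hdTQ, hdQ, fq_one_add, fq_one_add, coshift_conj_Q1, coshift_Q1]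
    have : c * (ε * ψ (P2p p m)) - c * (ε * ψ (P1p p m)) = -((m : ℤ) : ZMod p) := by
      rw [← mul_sub, ← mul_sub, ← hΔ, hcεΔ]
    push_cast at this ⊢
    linear_combination -this
  obtain ⟨w, hwadd, -, hwB⟩ := descentPair α β hm hαadd hβadd hC hκ
  -- the explicit conjugator `h ∈ Γ₀(pm)` with `h P_{1/p} = P_{2/p} h`
  obtain ⟨r, hr⟩ : ∃ r : ℕ, p = 2 * r + 1 := hp.odd_of_ne_two hp2
  have hcop : IsCoprime (p : ℤ) (m : ℤ) := Nat.isCoprime_iff_coprime.mpr ((Nat.Prime.coprime_iff_not_dvd hp).mpr hpm)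
  obtain ⟨u, v, huv⟩ := hcop
  have hr' : (p : ℤ) = 2 * r + 1 := by rw [hr]; push_cast; ring
  have hdet : (1 - 2 * (r : ℤ) + 2 * p * u * r) * (r + 1 - p * u * r) - (1 - 2 * u * r) * (-((p * m : ℕ) : ℤ) * (r * v)) = 1 := by
    push_cast
    linear_combination ((r : ℤ) - p * u * r) * hr' + ((p : ℤ) * r - 2 * u * p * r ^ 2) * huv
  set h : Gamma0 (p * m) := g0Of (1 - 2 * (r : ℤ) + 2 * p * u * r) (1 - 2 * u * r) (-((p * m : ℕ) : ℤ) * (r * v))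
    (r + 1 - p * u * r) hdet ⟨-(r * v), by ring⟩ with hh
  have hL : ((p * m : ℕ) : ℤ) ∣ -(p * (p * m) : ℤ) := ⟨-(p : ℤ), by push_cast; ring⟩
  set P1q : Gamma0 (p * m) := g0Of (1 - p * m) m (-(p * (p * m))) (1 + p * m) (by ring) hL with hP1q
  set P2q : Gamma0 (p * m) := g0Of (1 - 2 * (p * m)) (4 * m) (-(p * (p * m))) (1 + 2 * (p * m)) (by ring) hL with hP2q
  have hconj : h * P1q = P2q * h := by
    rw [hh, hP1q, hP2q]
    apply Subtype.ext
    simp only [g0Of, Subgroup.coe_mul]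
    ext i j
    fin_cases i <;> fin_cases j <;>
      simp [slOf, Matrix.mul_apply, Fin.sum_univ_two]
    · linear_combination (-((p : ℤ) * m)) * hr' + (4 * (p : ℤ) * m * r) * huv
    · linear_combination (3 * (m : ℤ)) * hr'
    · linear_combination (3 * (p : ℤ) ^ 2 * m * r) * huv
    · linear_combination ((p : ℤ) * m) * hr' - ((p : ℤ) * m * r) * huv
  have hP1B : P1q ∈ subB p m := g0Of_mem_subB _ _ _ _ _ _ ⟨-1, by push_cast; ring⟩
  have hP2B : P2q ∈ subB p m := g0Of_mem_subB _ _ _ _ _ _ ⟨-1, by push_cast; ring⟩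
  have hw12 : w P1q = w P2q := by
    have := congrArg w hconj
    rw [hwadd, hwadd] at this
    exact add_right_cancel (a := w P1q) (by rw [add_comm (w P1q), this, add_comm])
  rw [hwB _ hP1B, hwB _ hP2B] at hw12
  have hL9 : ((p * (p * m) : ℕ) : ℤ) ∣ -(p * (p * m) : ℤ) := ⟨-1, by push_cast; ring⟩
  have hβ1 : β P1q = -((m : ℤ) : ZMod p) - c * ψ (P1p p m) := by
    show fq p (((P1q : Gamma0 (p * m)) : SL(2, ℤ)) 1 1 : ℤ) - c * restr ψ P1q = _
    rw [hP1q, restr_g0Of ψ _ _ _ _ _ _ hL9]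
    simp only [g0Of, slOf_apply_11]
    rw [fq_one_add]
    rfl
  have hβ2 : β P2q = -((2 * m : ℤ) : ZMod p) - c * ψ (P2p p m) := by
    show fq p (((P2q : Gamma0 (p * m)) : SL(2, ℤ)) 1 1 : ℤ) - c * restr ψ P2q = _
    rw [hP2q, restr_g0Of ψ _ _ _ _ _ _ hL9]
    simp only [g0Of, slOf_apply_11]
    have e : fq p (1 + 2 * ((p : ℤ) * m)) = -((2 * m : ℤ) : ZMod p) := by
      rw [show (1 + 2 * ((p : ℤ) * m) : ℤ) = 1 + (p : ℤ) * (2 * m) by ring, fq_one_add]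
    rw [e]
    rfl
  rw [hβ1, hβ2] at hw12
  -- `hw12 : −m − c ψ(P1p) = −2m − c ψ(P2p)`, i.e. `c Δ = −m`; with `c ε Δ = −m` this forces `ε = 1`
  have h1 : c * Δ = -((m : ℤ) : ZMod p) := by
    rw [hΔ, mul_sub]; push_cast at hw12 ⊢; linear_combination hw12
  have h2 : c * Δ * (ε - 1) = 0 := by rw [mul_sub, mul_one, mul_assoc, mul_comm Δ ε, hcεΔ, h1, sub_self]
  rcases mul_eq_zero.mp h2 with h3 | h3
  · rw [h1, neg_eq_zero] at h3; exact hm0 h3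
  · exact hε1 (sub_eq_zero.mp h3)

/-- **`K^ε_p(pm) = 0 ⟹ K^ε_p(p²m) = 0` for `p ∤ m`, `ε ≠ 0, 1`, `p` odd** (coefficients `ℤ/p`). [new] -/
theorem stepEigen_of_not_dvd (hp2 : p ≠ 2) (hm : 0 < m) (hpm : ¬ p ∣ m) {ε : ZMod p} (hε0 : ε ≠ 0) (hε1 : ε ≠ 1)
    (hbase : ShiftEigenTrivialAtP p (p * m) ε) : ShiftEigenTrivialAtP p (p * (p * m)) ε := by
  intro ψ hadd hinv γ
  obtain ⟨w, hwadd, hwinv, hres⟩ := descent ψ ε hm hadd hinv (apply_P2p_eq_apply_P1p_of_eigen hp2 hm hpm ψ hε0 hε1 hadd hinv)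
  exact TwoShift.eq_zero_of_restrictsFrom (dvd_mul_left (p * m) p) hres (hbase w hwadd hwinv) γ

end PShiftEngine

end Summit.BirchSwinnertonDyer.BirchSwinnertonDyer.Theorems.ManinLocalTwoThree
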